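import Summits.MatrixMultiplication.MatrixMultiplication.Theorems.SoloInformedTranslateWorld

/-!
# Cross-intersecting pairs: the locking lemma CI′

This work, §8.8 (T10)(a), (T13)(a) / paper `C3-m2.md` §3 (gen 107). Setting of `SoloInformedPairStructure`
(CohnUmans2013, arXiv:1207.6528, Def. 12; coprime case, every chart): for two columns `j₀, j` the 2-sets
`P(i) = {[a(i,j₀)+a(i,j)], [a(i,j₀)−a(i,j)]}` and `Q(k) = {[b(j₀,k)+b(j,k)], [b(j₀,k)−b(j,k)]}` of sign classes
pairwise intersect (`Data.cross`). The combinatorial heart of the LOCKING LEMMA CI′, proved here over an arbitrary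
type with unordered pairs `Sym2`: two cross-intersecting families of (≤ 2)-sets, each with at least five distinct
members, have a COMMON point (`common_point_of_cross`); the one-sided version `star_of_cross` says that five distinct
members on one side already force the other side to be a star. Applied to classes this gives exact locking
`a(i,j) ∼ f i ± t j`, `b(j,k) ∼ l k ± t j` from a doubly-rich base slice (paper, `C3-m2.md` §3 Corollary).
References: this work §8.8 (T10), (T13); CohnUmans2013 Def. 12.
-/

namespace Summit.MatrixMultiplication.MatrixMultiplication.Theorems.TwistedTPP

namespace FibreLines

/-- **One-sided star lemma.** If the pairs `{p i, q i}` and `{x k, y k}` cross-intersect and the second family has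
at least five distinct members, then the first family is a star. [this work, §8.8 (T13)(a)] -/
theorem star_of_cross {ι κ α : Type*} [DecidableEq α] [Fintype κ] (p q : ι → α) (x y : κ → α)
    (hcross : ∀ i k, p i = x k ∨ p i = y k ∨ q i = x k ∨ q i = y k)
    (hQ : 5 ≤ ((Finset.univ : Finset κ).image (fun k => s(x k, y k))).card) :
    ∃ z, ∀ i, p i = z ∨ q i = z := by
  by_contra hstar
  push Not at hstar
  have hne : ((Finset.univ : Finset κ).image (fun k => s(x k, y k))).Nonempty := Finset.card_pos.mp (by omega)
  obtain ⟨e₀, he₀⟩ := hne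
  obtain ⟨k₀, -, -⟩ := Finset.mem_image.mp he₀
  obtain ⟨i₁, -, -⟩ := hstar (x k₀)
  obtain ⟨i₂, h2p, h2q⟩ := hstar (p i₁)
  obtain ⟨i₃, h3p, h3q⟩ := hstar (q i₁)
  have hsub : (Finset.univ : Finset κ).image (fun k => s(x k, y k)) ⊆
      {s(p i₁, p i₂), s(p i₁, q i₂), s(q i₁, p i₃), s(q i₁, q i₃)} := by
    intro e he
    obtain ⟨k, -, rfl⟩ := Finset.mem_image.mp he
    simp only [Finset.mem_insert, Finset.mem_singleton]
    have h2 := hcross i₂ k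
    have h3 := hcross i₃ k
    rcases hcross i₁ k with h | h | h | h
    · rcases h2 with e | e | e | e
      · exact absurd (e.trans h.symm) h2p
      · exact Or.inl (by rw [h, e])
      · exact absurd (e.trans h.symm) h2q
      · exact Or.inr (Or.inl (by rw [h, e]))
    · rcases h2 with e | e | e | e
      · exact Or.inl (by rw [h, e]; exact Sym2.eq_swap)
      · exact absurd (e.trans h.symm) h2p
      · exact Or.inr (Or.inl (by rw [h, e]; exact Sym2.eq_swap))
      · exact absurd (e.trans h.symm) h2q
    · rcases h3 with e | e | e | e
      · exact absurd (e.trans h.symm) h3p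
      · exact Or.inr (Or.inr (Or.inl (by rw [h, e])))
      · exact absurd (e.trans h.symm) h3q
      · exact Or.inr (Or.inr (Or.inr (by rw [h, e])))
    · rcases h3 with e | e | e | e
      · exact Or.inr (Or.inr (Or.inl (by rw [h, e]; exact Sym2.eq_swap)))
      · exact absurd (e.trans h.symm) h3p
      · exact Or.inr (Or.inr (Or.inr (by rw [h, e]; exact Sym2.eq_swap)))
      · exact absurd (e.trans h.symm) h3q
  have hle := (Finset.card_le_card hsub).trans Finset.card_le_four
  omega

/-- **Lemma CI′ (common point).** Two cross-intersecting families of (≤ 2)-sets, each with at least five distinct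
members, have a common point. [this work, §8.8 (T13)(a); `C3-m2.md` §3] -/
theorem common_point_of_cross {ι κ α : Type*} [DecidableEq α] [Fintype ι] [Fintype κ] (p q : ι → α)
    (x y : κ → α) (hcross : ∀ i k, p i = x k ∨ p i = y k ∨ q i = x k ∨ q i = y k)
    (hP : 5 ≤ ((Finset.univ : Finset ι).image (fun i => s(p i, q i))).card)
    (hQ : 5 ≤ ((Finset.univ : Finset κ).image (fun k => s(x k, y k))).card) :
    ∃ z, (∀ i, p i = z ∨ q i = z) ∧ (∀ k, x k = z ∨ y k = z) := by
  have hcross' : ∀ k i, x k = p i ∨ x k = q i ∨ y k = p i ∨ y k = q i := by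
    intro k i
    rcases hcross i k with h | h | h | h
    · exact Or.inl h.symm
    · exact Or.inr (Or.inr (Or.inl h.symm))
    · exact Or.inr (Or.inl h.symm)
    · exact Or.inr (Or.inr (Or.inr h.symm))
  obtain ⟨z, hz⟩ := star_of_cross x y p q hcross' hP
  by_cases hall : ∀ i, p i = z ∨ q i = z
  · exact ⟨z, hall, hz⟩
  · push Not at hall
    obtain ⟨i₀, hp0, hq0⟩ := hall
    exfalso
    have hsub : (Finset.univ : Finset κ).image (fun k => s(x k, y k)) ⊆ {s(z, p i₀), s(z, q i₀)} := by
      intro e he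
      obtain ⟨k, -, rfl⟩ := Finset.mem_image.mp he
      simp only [Finset.mem_insert, Finset.mem_singleton]
      have hc := hcross i₀ k
      rcases hz k with h | h
      · rcases hc with e | e | e | e
        · exact absurd (e.trans h) hp0
        · exact Or.inl (by rw [h, e])
        · exact absurd (e.trans h) hq0
        · exact Or.inr (by rw [h, e])
      · rcases hc with e | e | e | e
        · exact Or.inl (by rw [h, e]; exact Sym2.eq_swap)
        · exact absurd (e.trans h) hp0
        · exact Or.inr (by rw [h, e]; exact Sym2.eq_swap)
        · exact absurd (e.trans h) hq0
    have hle := (Finset.card_le_card hsub).trans Finset.card_le_two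
    omega

/-! ### The locking corollary for twisted data -/

variable {ι G : Type*} [AddCommGroup G]

/-- `f + a ∼ t` gives `a ∼ f + t` or `a ∼ f - t`. -/
theorem signEq_shift_of_signEq_add {f a t : G} (h : SignEq (f + a) t) : SignEq a (f + t) ∨ SignEq a (f - t) := by
  rcases h with h | h
  · right; right
    have e : a = -(f - t) := by rw [← h]; abel
    exact e
  · left; right
    have e : a = -(f + t) := by
      have e' : a = (f + a) - f := by abel
      rw [e', h]; abel
    exact e

/-- `f - a ∼ t` gives `a ∼ f + t` or `a ∼ f - t`. -/
theorem signEq_shift_of_signEq_sub {f a t : G} (h : SignEq (f - a) t) : SignEq a (f + t) ∨ SignEq a (f - t) := by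
  rcases h with h | h
  · right; left
    rw [← h]; abel
  · left; left
    have e' : a = f - (f - a) := by abel
    rw [e', h]; abel

/-- **Exact locking from a doubly-rich pair (Lemma CI′ for twisted data).** With a genuine class map `κ`
(`κ x = κ y ↔ x ∼ y`): if for the column pair `(j₀, j)` the families `P(i) = {[a(i,j₀) ± a(i,j)]}` and
`Q(k) = {[b(j₀,k) ± b(j,k)]}` each have at least five distinct members, then one parameter `t` locks both:
`a(i,j) ∼ a(i,j₀) ± t` for all `i` and `b(j,k) ∼ b(j₀,k) ± t` for all `k`. [this work, §8.8 (T13)(a); `C3-m2.md` §3] -/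
theorem Data.locked_of_cross_rich [Fintype ι] [DecidableEq ι] {R : Type*} [DecidableEq R] (D : Data ι G)
    (κ : G → R) (hκ : ∀ x y, κ x = κ y ↔ SignEq x y) (j₀ j : ι)
    (hP : 5 ≤ ((Finset.univ : Finset ι).image
      (fun i => s(κ (D.a i j₀ + D.a i j), κ (D.a i j₀ - D.a i j)))).card)
    (hQ : 5 ≤ ((Finset.univ : Finset ι).image
      (fun k => s(κ (D.b j₀ k + D.b j k), κ (D.b j₀ k - D.b j k)))).card) :
    ∃ t : G, (∀ i, SignEq (D.a i j) (D.a i j₀ + t) ∨ SignEq (D.a i j) (D.a i j₀ - t)) ∧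
      (∀ k, SignEq (D.b j k) (D.b j₀ k + t) ∨ SignEq (D.b j k) (D.b j₀ k - t)) := by
  have hcross : ∀ i k, κ (D.a i j₀ + D.a i j) = κ (D.b j₀ k + D.b j k) ∨
      κ (D.a i j₀ + D.a i j) = κ (D.b j₀ k - D.b j k) ∨ κ (D.a i j₀ - D.a i j) = κ (D.b j₀ k + D.b j k) ∨
      κ (D.a i j₀ - D.a i j) = κ (D.b j₀ k - D.b j k) := by
    intro i k
    rcases D.cross i j₀ j k with h | h | h | h
    · exact Or.inl ((hκ _ _).mpr h)
    · exact Or.inr (Or.inl ((hκ _ _).mpr h))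
    · exact Or.inr (Or.inr (Or.inl ((hκ _ _).mpr h)))
    · exact Or.inr (Or.inr (Or.inr ((hκ _ _).mpr h)))
  obtain ⟨z, hzP, hzQ⟩ := common_point_of_cross _ _ _ _ hcross hP hQ
  have hne : ((Finset.univ : Finset ι).image
      (fun k => s(κ (D.b j₀ k + D.b j k), κ (D.b j₀ k - D.b j k)))).Nonempty := Finset.card_pos.mp (by omega)
  obtain ⟨e₀, he₀⟩ := hne
  obtain ⟨k₀, -, -⟩ := Finset.mem_image.mp he₀
  obtain ⟨t, ht⟩ : ∃ t : G, κ t = z := by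
    rcases hzQ k₀ with h | h
    · exact ⟨_, h⟩
    · exact ⟨_, h⟩
  refine ⟨t, fun i => ?_, fun k => ?_⟩
  · rcases hzP i with h | h
    · exact signEq_shift_of_signEq_add ((hκ _ _).mp (h.trans ht.symm))
    · exact signEq_shift_of_signEq_sub ((hκ _ _).mp (h.trans ht.symm))
  · rcases hzQ k with h | h
    · exact signEq_shift_of_signEq_add ((hκ _ _).mp (h.trans ht.symm))
    · exact signEq_shift_of_signEq_sub ((hκ _ _).mp (h.trans ht.symm))

end FibreLines

end Summit.MatrixMultiplication.MatrixMultiplication.Theorems.TwistedTPP
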